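import Summits.HodgeConjecture.CorCM.MumfordTateRankSevenTypeThreeConverse
import HarnessLib

/-!
# Type III over `ℚ`: the Lefschetz bound `dim Lie Hg(H¹B) ≤ m(2m-1)` in dimension `2m`, and in dimension `4`
# `Lie Hg(H¹B) = C(End⁰B) ∩ 𝔰𝔭(H¹B, ψ)` — the Hodge Lie algebra IS the Lefschetz Lie algebra

COR-CM (cell `pub-hodgecm2`, seat `b27` gen 44, count-neutral Mumford–Tate-rank ladder; theorems only, no definition, no named
fact; UNCONDITIONAL — nothing here uses or asserts HC_CM).  Sequel of `CorCM/MumfordTateRankSevenTypeThreeConverse`, which proved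
`dim Lie Hg(H¹B) ≤ 6` and `dim MT(H¹B) = 7` for a simple abelian FOURFOLD `B` whose endomorphism algebra is a totally definite
quaternion algebra over `ℚ`.  Here:

* `exists_skew_quaternion_pair_of_isTotallyDefinite` — the set-up once and for all: for `B` simple with `End⁰B` a totally
  definite quaternion algebra over `ℚ` and ANY polarization `ψ` of `H¹B`, there are `i, j ∈ End_Hdg(H¹B)` and `a, b ∈ ℚ×` with
  `i² = a`, `j² = b`, `ij = -ji`, `i† = -i`, `j† = -j` (`†` the `ψ`-adjoint: the Rosati involution is the canonical involution,
  Lange Thm. 2.6.5 (c), transported along Riemann's `bettiRep`).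
* `finrank_centralizer_inf_skewAdjoint_eq` — for such a pair on any polarized Hodge structure with antisymmetric `ψ`:
  `8 · dim (C(i, j) ∩ 𝔰𝔭(ψ)) + 2d = d²`, `d = dim V` (`Literature/Algebra/Lie/QuaternionCentralizerSkewDimension` +
  `…/SymplecticAlgebraDimension`).
* **`finrank_hodgeLie_hodge_one_le_of_isTotallyDefinite`**, **`mtRank_hodge_one_le_of_isTotallyDefinite`** — THE LEFSCHETZ BOUND
  for type III over `ℚ` in every dimension: `B` simple, `dim B = 2m`, `End⁰B` a totally definite quaternion algebra over `ℚ` ⟹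
  `dim Lie Hg(H¹B) ≤ m(2m - 1)` and `dim MT(H¹B) ≤ m(2m - 1) + 1` — Milne 1999 §2, Summary: the Lefschetz group of type III has
  dimension `g²/2f - g/2` (`f = [F : ℚ] = 1`, `g = 2m`), and `Hg ⊆` Lefschetz (Moonen–Zarhin §1 `Hg(X) ⊂ Sp_D(V, φ)`).
* **`hodgeLie_hodge_one_eq_centralizer_inf_skewAdjoint_of_fourfold`** — for `m = 2`: **`Lie Hg(H¹B) = C_{End H¹B}(End_Hdg H¹B) ∩
  𝔰𝔭(H¹B, ψ)`** for every polarization `ψ`: the Hodge Lie algebra EQUALS the Lefschetz Lie algebra — Moonen–Zarhin 1999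
  Thm. (0.1) (2), case (c) «`Hg(X) = Sp_D(V, φ)`», at the level of Lie algebras (`⊆` always; `dim = 6` on both sides by
  `CorCM/MumfordTateRankSevenTypeThreeConverse`).

## References
* [MoonenZarhin1999LowDim] B. Moonen, Yu. Zarhin, Math. Ann. 315 (1999), Thm. (0.1) (2) (case (c)) and §1 (`Hg(X) ⊂ Sp_D(V, φ)`).
* [Milne1999LefschetzClasses] J. S. Milne, Duke Math. J. 96 (1999), §2 (type III) and Summary (`dim = g²/2f - g/2`).
* [Lange2023AbelianVarietiesComplex] H. Lange, *Abelian Varieties over the Complex Numbers* (2023), §2.6.2 Thm. 2.6.5 (c).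
-/

noncomputable section

open scoped TensorProduct Quaternion
open CategoryTheory CategoryTheory.Limits Module

namespace Summit.HodgeConjecture.CorCM

open Literature.AlgebraicGeometry.Motives
open Literature.AlgebraicGeometry.Motives.AbelianVariety
open Literature.AlgebraicGeometry.Motives.HodgeStructure
open Literature.AlgebraicGeometry.HodgeTheory
open Literature.AlgebraicGeometry.ComplexMultiplication (bettiRep bettiRep_injective)
open Literature.AlgebraicGeometry.Milne1999 (IsOfCMType)
open Literature.NumberTheory.Automorphic (IsQuaternionAlgebra IsTotallyDefinite standardInvolution
  standardInvolution_algEquiv standardInvolution_quaternionAlgebra exists_algEquiv_quaternionAlgebra_of_isTotallyDefinite)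
open Literature.RingTheory.CentralSimple
open Literature.Algebra.Lie

variable [HodgeTensorFacts.{0, 0}]

/-! ## §1 The set-up: a `ψ`-skew anticommuting quaternion pair in `End_Hdg(H¹B)` -/

/-- **A `ψ`-skew anticommuting quaternion pair in `End_Hdg(H¹B)`.**  For `B` simple with `End⁰B` a totally definite quaternion
algebra over `ℚ` and a polarization `ψ` of `H¹B`: there are Hodge endomorphisms `i, j` of `H¹B` and `a, b ∈ ℚ×` with
`i² = a`, `j² = b`, `ij = -ji`, `i† = -i`, `j† = -j` — the images under Riemann's anti-isomorphism `bettiRep` of a quaternion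
basis of `End⁰B ≅ (a, b / ℚ)`, skew because the Rosati involution of a positive pair of the first kind on a definite quaternion
algebra is the canonical involution. [cite: Lange2023AbelianVarietiesComplex, §2.6.2 Thm. 2.6.5 (c)]
[cite: MoonenZarhin1999LowDim, §1] -/
theorem exists_skew_quaternion_pair_of_isTotallyDefinite {B : AbelianVariety ℂ} {k : ℕ} (hB : IsSmoothProjective k B.X)
    (hBs : B.IsSimple) [IsQuaternionAlgebra ℚ B.endAlgebra] (hdef : IsTotallyDefinite ℚ B.endAlgebra)
    [Module.Finite ℚ (bettiCohomology B.X 1)] (ψ : (BettiUniverse.hodge exists_isReal_hodgeModel_holds hB 1).Polarization) :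
    ∃ (a b : ℚ) (i j : Module.End ℚ (bettiCohomology B.X 1)), a ≠ 0 ∧ b ≠ 0 ∧
      i * i = algebraMap ℚ _ a ∧ j * j = algebraMap ℚ _ b ∧ i * j = -(j * i) ∧
      i ∈ (BettiUniverse.hodge exists_isReal_hodgeModel_holds hB 1).endAlg ∧
      j ∈ (BettiUniverse.hodge exists_isReal_hodgeModel_holds hB 1).endAlg ∧ ψ.adjoint i = -i ∧ ψ.adjoint j = -j := by
  classical
  have hk : B.dim = k := schemeDim_eq_holds hB
  subst hk
  have hHD : exists_isReal_hodgeModel := exists_isReal_hodgeModel_holds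
  have hI : hodgePQ_independent_of_hodgeModel := hodgePQ_independent_of_hodgeModel_holds
  -- the Rosati involution is the canonical involution of the definite quaternion algebra `End⁰B`
  have hD : ∀ x : B.endAlgebra, x ≠ 0 → IsUnit x := fun x hx => (isUnit_or_eq_zero_of_isSimple hBs x).resolve_right hx
  have hA4 : HasNoTypeIVFactor B := AbelianVariety.hasNoTypeIVFactor_of_isTotallyReal (K := ℚ)
  have hpos := AbelianVariety.isPositiveAntiInvolution_rosati (A := B) hHD hI ψ
  have h1 := AbelianVariety.isOfFirstKind_rosati (A := B) hHD hI ψ hA4 (K := ℚ)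
  have hros : ∀ x, AbelianVariety.rosati B hHD hI ψ x = standardInvolution ℚ B.endAlgebra x := by
    obtain ⟨-, h⟩ := (isPositiveAntiInvolution_iff_of_isOfFirstKind ℚ hD h1).mp hpos
    rcases h with ⟨-, h⟩ | ⟨hind, -⟩
    · exact h
    · exact absurd (hind.isSplitAtInfinite Rat.infinitePlace) (hdef Rat.infinitePlace)
  -- a quaternion basis of `End⁰B ≅ (a, b / ℚ)`
  obtain ⟨a, b, ha, hb, ⟨e⟩⟩ := exists_algEquiv_quaternionAlgebra_of_isTotallyDefinite B.endAlgebra hdef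
  set q := (QuaternionAlgebra.Basis.self ℚ).compHom (e.symm : ℍ[ℚ,a,b] →ₐ[ℚ] B.endAlgebra) with hq
  have hqi : q.i = e.symm ⟨0, 1, 0, 0⟩ := rfl
  have hqj : q.j = e.symm ⟨0, 0, 1, 0⟩ := rfl
  have hstar_i : standardInvolution ℚ B.endAlgebra q.i = -q.i := by
    rw [hqi, standardInvolution_algEquiv, standardInvolution_quaternionAlgebra, ← map_neg]
    congr 1
    ext <;> simp
  have hstar_j : standardInvolution ℚ B.endAlgebra q.j = -q.j := by
    rw [hqj, standardInvolution_algEquiv, standardInvolution_quaternionAlgebra, ← map_neg]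
    congr 1
    ext <;> simp
  -- transport along `bettiRep`
  let ρ : B.endAlgebra → Module.End ℚ (bettiCohomology B.X 1) := fun z => MulOpposite.unop (bettiRep B z)
  have hρ : ∀ z, ρ z = MulOpposite.unop (bettiRep B z) := fun z => rfl
  have hρmul : ∀ z w, ρ (z * w) = ρ w * ρ z := fun z w => by rw [hρ, map_mul, MulOpposite.unop_mul]
  have hρneg : ∀ z, ρ (-z) = -ρ z := fun z => by rw [hρ, map_neg, MulOpposite.unop_neg]
  have hρsmul : ∀ (c : ℚ) z, ρ (c • z) = c • ρ z := fun c z => by rw [hρ, map_smul, MulOpposite.unop_smul]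
  have hρone : ρ 1 = 1 := by rw [hρ, map_one, MulOpposite.unop_one]
  have hρA : ∀ z, ρ z ∈ (BettiUniverse.hodge exists_isReal_hodgeModel_holds hB 1).endAlg := fun z => by
    rw [hρ]
    exact Literature.AlgebraicGeometry.ComplexMultiplication.unop_bettiRep_mem_endAlg hHD hI z
  have hτρ : ∀ z, ψ.adjoint (ρ z) = ρ (AbelianVariety.rosati B hHD hI ψ z) := fun z => by
    rw [hρ, hρ, AbelianVariety.unop_bettiRep_rosati]
  refine ⟨a, b, ρ q.i, ρ q.j, ha.ne, hb.ne, ?_, ?_, ?_, hρA q.i, hρA q.j, ?_, ?_⟩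
  · rw [← hρmul, q.i_mul_i, zero_smul, add_zero, hρsmul, hρone, Algebra.algebraMap_eq_smul_one]
  · rw [← hρmul, q.j_mul_j, hρsmul, hρone, Algebra.algebraMap_eq_smul_one]
  · rw [← hρmul, ← hρmul, q.j_mul_i, q.i_mul_j, zero_smul, zero_sub, hρneg]
  · rw [hτρ, hros, hstar_i, hρneg]
  · rw [hτρ, hros, hstar_j, hρneg]

/-! ## §2 The count `8 · dim (C(i, j) ∩ 𝔰𝔭(ψ)) + 2d = d²` on a polarized Hodge structure -/

omit [HodgeTensorFacts.{0, 0}] in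
/-- **`8 · dim (C(i, j) ∩ 𝔰𝔭(V, ψ)) + 2d = d²`** (i.e. `dim = d(d-2)/8`) for an anticommuting pair `i² = a`, `j² = b` (`a, b ≠ 0`) of `ψ`-skew
endomorphisms of a polarized `ℚ`-Hodge structure with ANTISYMMETRIC polarization form (`d = dim V`): the algebra count
`8 dim C⁻ + 4 dim 𝔰𝔭 = 3 dim End` (`QuaternionCentralizer.eight_mul_finrank_centralizer_skew_add`, with `†` as the linear
anti-involution `τ`, `ker(τ + 1) = 𝔰𝔭(ψ)`) and `2 dim 𝔰𝔭 = d(d+1)` (`SymplecticDimension`). [cite: Milne1999LefschetzClasses, §2 (type III) and Summary] -/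
theorem finrank_centralizer_inf_skewAdjoint_eq {V : Type} [AddCommGroup V] [Module ℚ V] [Module.Finite ℚ V] {n : ℤ}
    {H : HodgeStructure V n} (ψ : H.Polarization) (hflip : ψ.form.flip = -ψ.form) {i j : Module.End ℚ V} {a b : ℚ}
    (ha : a ≠ 0) (hb : b ≠ 0) (hi : i * i = algebraMap ℚ _ a) (hj : j * j = algebraMap ℚ _ b) (hij : i * j = -(j * i))
    (hτi : ψ.adjoint i = -i) (hτj : ψ.adjoint j = -j) :
    8 * Module.finrank ℚ ↥(Subalgebra.toSubmodule (Subalgebra.centralizer ℚ ({i, j} : Set (Module.End ℚ V))) ⊓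
        ψ.form.skewAdjointSubmodule) + 2 * Module.finrank ℚ V = Module.finrank ℚ V * Module.finrank ℚ V := by
  -- `†` as a linear anti-involution
  let τ : Module.End ℚ V →ₗ[ℚ] Module.End ℚ V :=
    { toFun := ψ.adjoint, map_add' := ψ.adjoint_add, map_smul' := fun c x => ψ.adjoint_smul c x }
  have hτ : ∀ Y, τ Y = ψ.adjoint Y := fun _ => rfl
  have hτm : ∀ Y Z, τ (Y * Z) = τ Z * τ Y := fun Y Z => by rw [hτ, hτ, hτ, ψ.adjoint_mul]
  have hττ : ∀ Y, τ (τ Y) = Y := fun Y => by rw [hτ, hτ, ψ.adjoint_adjoint]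
  have hskew : LinearMap.ker (τ + LinearMap.id) = ψ.form.skewAdjointSubmodule := by
    ext Y
    rw [QuaternionCentralizer.mem_ker_add_id_iff, hτ, LinearMap.mem_skewAdjointSubmodule]
    constructor
    · intro h v w
      rw [Pi.neg_apply, ← LinearMap.neg_apply, ← h]
      exact (ψ.form_apply_adjoint Y v w).symm
    · intro h
      refine (ψ.eq_adjoint_of_isAdjointPair fun v w => ?_).symm
      rw [h v w, Pi.neg_apply, LinearMap.neg_apply]
  have hs := SymplecticDimension.two_mul_finrank_skewAdjointSubmodule_of_flip_eq_neg ψ.form ψ.nondegenerate hflip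
  have hE : Module.finrank ℚ (Module.End ℚ V) = Module.finrank ℚ V * Module.finrank ℚ V := Module.finrank_linearMap _ _ _ _
  have hcount := QuaternionCentralizer.eight_mul_finrank_centralizer_skew_add (K := ℚ) (E := Module.End ℚ V) ha hb hi hj
    hij τ hτm hττ (by rw [hτ, hτi]) (by rw [hτ, hτj])
  rw [hskew, hE] at hcount
  -- `8 c + 4 s = 3 d²`, `2 s = d (d + 1)`
  zify at hcount hs ⊢
  linear_combination hcount - 2 * hs

/-! ## §3 The Lefschetz bound for type III over `ℚ`: `dim Lie Hg(H¹B) ≤ m(2m-1)` -/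

/-- **The Lefschetz bound, type III over `ℚ`:** for a simple complex abelian variety `B` of dimension `2m` whose endomorphism
algebra is a totally definite quaternion algebra over `ℚ`, **`dim Lie Hg(H¹B) ≤ m(2m-1)`** — `Lie Hg` commutes with
`End_Hdg(H¹B)` and is `ψ`-skew (Moonen–Zarhin §1 `Hg(X) ⊂ Sp_D(V, φ)`), so it lies in `C(i, j) ∩ 𝔰𝔭(ψ)` for the skew quaternion
pair of §1, of dimension `d(d-2)/8 = m(2m-1)` (`d = 4m`; Milne's `g²/2 - g/2`, `g = 2m`).
[cite: Milne1999LefschetzClasses, §2 (type III) and Summary] [cite: MoonenZarhin1999LowDim, §1] -/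
theorem finrank_hodgeLie_hodge_one_le_of_isTotallyDefinite {B : AbelianVariety ℂ} {k : ℕ} (hB : IsSmoothProjective k B.X)
    (hBs : B.IsSimple) {m : ℕ} (hBm : B.dim = 2 * m) [IsQuaternionAlgebra ℚ B.endAlgebra]
    (hdef : IsTotallyDefinite ℚ B.endAlgebra) :
    haveI := BettiUniverse.finite hB 1
    Module.finrank ℚ (BettiUniverse.hodge exists_isReal_hodgeModel_holds hB 1).hodgeLie ≤ m * (2 * m - 1) := by
  classical
  haveI := BettiUniverse.finite hB 1
  set H := BettiUniverse.hodge exists_isReal_hodgeModel_holds hB 1 with hH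
  obtain ⟨ψ⟩ := BettiUniverse.hodge_isPolarizable exists_isReal_hodgeModel_holds hB 1
  obtain ⟨a, b, i, j, ha, hb, hi, hj, hij, hiA, hjA, hτi, hτj⟩ :=
    exists_skew_quaternion_pair_of_isTotallyDefinite hB hBs hdef ψ
  -- `Lie Hg ⊆ C(i, j) ∩ 𝔰𝔭(ψ)`
  have hle : H.hodgeLie ≤ Subalgebra.toSubmodule
      (Subalgebra.centralizer ℚ ({i, j} : Set (Module.End ℚ (bettiCohomology B.X 1)))) ⊓ ψ.form.skewAdjointSubmodule := by
    intro Y hY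
    refine Submodule.mem_inf.2 ⟨?_, ?_⟩
    · rw [Subalgebra.mem_toSubmodule, Subalgebra.mem_centralizer_iff]
      intro g hg
      simp only [Set.mem_insert_iff, Set.mem_singleton_iff] at hg
      rcases hg with rfl | rfl
      · exact (commute_of_mem_hodgeLie H hY ⟨_, hiA⟩).symm
      · exact (commute_of_mem_hodgeLie H hY ⟨_, hjA⟩).symm
    · rw [LinearMap.mem_skewAdjointSubmodule]
      intro v w
      rw [Pi.neg_apply, map_neg, ← add_eq_zero_iff_eq_neg]
      exact form_apply_add_eq_zero_of_mem_hodgeLie ψ hY v w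
  have hflip : ψ.form.flip = -ψ.form := by
    rw [ψ.flip_form, show (((1 : ℕ) : ℤ).negOnePow : ℤˣ) = -1 from Int.negOnePow_one, Units.val_neg, Units.val_one,
      neg_one_zsmul]
  have hcount := finrank_centralizer_inf_skewAdjoint_eq ψ hflip ha hb hi hj hij hτi hτj
  have hdimV : Module.finrank ℚ (bettiCohomology B.X 1) = 4 * m := by
    rw [finrank_bettiCohomology_one_eq_two_mul_dim B, hBm]; ring
  rw [hdimV] at hcount
  refine (Submodule.finrank_mono hle).trans (le_of_eq ?_)
  rcases Nat.eq_zero_or_pos m with rfl | hm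
  · omega
  · have h2m : 1 ≤ 2 * m := by omega
    zify [h2m] at hcount ⊢
    nlinarith [hcount]

/-- **`dim MT(H¹B) ≤ m(2m-1) + 1`** for `B` simple of dimension `2m > 0` with `End⁰B` a totally definite quaternion algebra over
`ℚ` (`dim MT = dim Lie Hg + 1`). [cite: Milne1999LefschetzClasses, §2 (type III) and Summary] [cite: MoonenZarhin1999LowDim, §1] -/
theorem mtRank_hodge_one_le_of_isTotallyDefinite {B : AbelianVariety ℂ} {k : ℕ} (hB : IsSmoothProjective k B.X)
    (hBs : B.IsSimple) {m : ℕ} (hm : 0 < m) (hBm : B.dim = 2 * m) [IsQuaternionAlgebra ℚ B.endAlgebra]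
    (hdef : IsTotallyDefinite ℚ B.endAlgebra) :
    haveI := BettiUniverse.finite hB 1
    (BettiUniverse.hodge exists_isReal_hodgeModel_holds hB 1).mtRank ≤ m * (2 * m - 1) + 1 := by
  haveI := BettiUniverse.finite hB 1
  have h0 : 0 < B.dim := by omega
  have h := finrank_hodgeLie_hodge_one_le_of_isTotallyDefinite hB hBs hBm hdef
  rw [mtRank_hodge_one_eq_finrank_hodgeLie_add_one hB h0]
  omega

/-! ## §4 Dimension `4`: the Hodge Lie algebra is the Lefschetz Lie algebra -/

/-- **`Lie Hg(H¹B) = C_{End H¹B}(End_Hdg H¹B) ∩ 𝔰𝔭(H¹B, ψ)` for a simple abelian FOURFOLD with totally definite quaternion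
multiplication over `ℚ`** and every polarization `ψ`: the Hodge Lie algebra EQUALS the Lefschetz Lie algebra (the
`ψ`-skew endomorphisms commuting with all Hodge endomorphisms) — Moonen–Zarhin 1999 Thm. (0.1) (2), case (c):
«`Hg(X) = Sp_D(V, φ)`», at the level of Lie algebras.  `⊆` holds for every polarized Hodge structure; both sides have dimension
`6`: the left by `dim MT(H¹B) = 7` (`CorCM/MumfordTateRankSevenTypeThreeConverse`), the right because it lies in
`C(i, j) ∩ 𝔰𝔭(ψ)` (§2: dimension `6`) and contains `Lie Hg`. [cite: MoonenZarhin1999LowDim, Thm. (0.1) (2) and §1]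
[cite: Milne1999LefschetzClasses, §2 (type III) and Summary] -/
theorem hodgeLie_hodge_one_eq_centralizer_inf_skewAdjoint_of_fourfold {B : AbelianVariety ℂ} {k : ℕ}
    (hB : IsSmoothProjective k B.X) (hBs : B.IsSimple) (hB4 : B.dim = 4) [IsQuaternionAlgebra ℚ B.endAlgebra]
    (hdef : IsTotallyDefinite ℚ B.endAlgebra) [Module.Finite ℚ (bettiCohomology B.X 1)]
    (ψ : (BettiUniverse.hodge exists_isReal_hodgeModel_holds hB 1).Polarization) :
    (BettiUniverse.hodge exists_isReal_hodgeModel_holds hB 1).hodgeLie =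
      Subalgebra.toSubmodule (Subalgebra.centralizer ℚ
          ((BettiUniverse.hodge exists_isReal_hodgeModel_holds hB 1).endAlg : Set (Module.End ℚ (bettiCohomology B.X 1)))) ⊓
        ψ.form.skewAdjointSubmodule := by
  classical
  have hk : B.dim = k := schemeDim_eq_holds hB
  obtain ⟨a, b, i, j, ha, hb, hi, hj, hij, hiA, hjA, hτi, hτj⟩ :=
    exists_skew_quaternion_pair_of_isTotallyDefinite hB hBs hdef ψ
  -- `⊆`
  have hle : (BettiUniverse.hodge exists_isReal_hodgeModel_holds hB 1).hodgeLie ≤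
      Subalgebra.toSubmodule (Subalgebra.centralizer ℚ
        ((BettiUniverse.hodge exists_isReal_hodgeModel_holds hB 1).endAlg : Set (Module.End ℚ (bettiCohomology B.X 1))))
      ⊓ ψ.form.skewAdjointSubmodule := by
    intro Y hY
    refine Submodule.mem_inf.2 ⟨?_, ?_⟩
    · rw [Subalgebra.mem_toSubmodule, Subalgebra.mem_centralizer_iff]
      intro g hg
      exact (commute_of_mem_hodgeLie _ hY ⟨g, hg⟩).symm
    · rw [LinearMap.mem_skewAdjointSubmodule]
      intro v w
      rw [Pi.neg_apply, map_neg, ← add_eq_zero_iff_eq_neg]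
      exact form_apply_add_eq_zero_of_mem_hodgeLie ψ hY v w
  -- the Lefschetz Lie algebra lies in `C(i, j) ∩ 𝔰𝔭(ψ)`, of dimension `6`
  have hle' : Subalgebra.toSubmodule (Subalgebra.centralizer ℚ
        ((BettiUniverse.hodge exists_isReal_hodgeModel_holds hB 1).endAlg : Set (Module.End ℚ (bettiCohomology B.X 1))))
      ⊓ ψ.form.skewAdjointSubmodule ≤ Subalgebra.toSubmodule
      (Subalgebra.centralizer ℚ ({i, j} : Set (Module.End ℚ (bettiCohomology B.X 1)))) ⊓ ψ.form.skewAdjointSubmodule := by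
    refine inf_le_inf_right _ fun Y hY => ?_
    rw [Subalgebra.mem_toSubmodule] at hY ⊢
    refine Subalgebra.centralizer_le ℚ _ _ ?_ hY
    intro g hg
    simp only [Set.mem_insert_iff, Set.mem_singleton_iff] at hg
    rcases hg with rfl | rfl
    · exact hiA
    · exact hjA
  have hflip : ψ.form.flip = -ψ.form := by
    rw [ψ.flip_form, show (((1 : ℕ) : ℤ).negOnePow : ℤˣ) = -1 from Int.negOnePow_one, Units.val_neg, Units.val_one,
      neg_one_zsmul]
  have hcount := finrank_centralizer_inf_skewAdjoint_eq ψ hflip ha hb hi hj hij hτi hτj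
  have hdimV : Module.finrank ℚ (bettiCohomology B.X 1) = 8 := by rw [finrank_bettiCohomology_one_eq_two_mul_dim B, hB4]
  rw [hdimV] at hcount
  -- `dim Lie Hg = 6`
  obtain ⟨h7, -, -, -⟩ := mtRank_hodge_one_eq_seven_of_isSimple_fourfold_of_isTotallyDefinite hB hBs hB4 hdef
  have ht := mtRank_hodge_one_eq_finrank_hodgeLie_add_one hB (by omega)
  have h6 : Module.finrank ℚ (BettiUniverse.hodge exists_isReal_hodgeModel_holds hB 1).hodgeLie = 6 := by
    change (BettiUniverse.hodge exists_isReal_hodgeModel_holds hB 1).mtRank = 7 at h7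
    change (BettiUniverse.hodge exists_isReal_hodgeModel_holds hB 1).mtRank =
      Module.finrank ℚ (BettiUniverse.hodge exists_isReal_hodgeModel_holds hB 1).hodgeLie + 1 at ht
    omega
  refine Submodule.eq_of_le_of_finrank_le hle ?_
  have hfin := Submodule.finrank_mono hle'
  omega

end Summit.HodgeConjecture.CorCM

end
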